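import Mathlib
import Summits.KontsevichZagierPeriods.Zeta5Search.Certificates.RayC1KernelBigPrime
import Summits.KontsevichZagierPeriods.Zeta5Search.ClusterValuationPairs
import HarnessLib

/-!
# ζ(5) search — RHIN–VIOLA SHIFT LAWS on the ray C1: class exponents and pole counts under `n ↦ n + p` (fam-rv g17, PROOFS)

HONEST FRAMING: systematic search; no irrationality claim unless certified.  Pure combinatorics of the explicit integer vector
`b(n) = n·(85; 35,32,30,27,25,22,20)` and a prime `p`; nothing about `ζ(5)`; every exponent this could ever feed is `< 1`.

OUR work (Summit side; family-designer seat `fam-rv`, generation 17).  The Rhin–Viola mechanism below `θ = p/n = 1` for a ray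
with integer slopes: the translation `n ↦ n + p` moves every block end point `β·n` by the multiple `β·p` of `p`, so every
residue class modulo `p` gains exactly `β' − β` points in the region between consecutive end points — independently of the class.  Hence
(`classExp_shift`) EVERY class exponent drops by the weight `Σ_j (85 − 2β_j) − 85 = 128` and (`classPoleCount_shift`) every class gains
exactly `63 − 22 = 41` poles; no window hypothesis, every odd prime, every residue.  Route: `classExp` as residue COUNTS
(`classExp_eq_counts`, general `b`; the two centre conventions merge into `[p ∣ 2x − b₀]`), the counts through `Nat.count_modEq_card`
(`cnt_eq`), and `cnt (N + k·p) = cnt N + k`.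
-/

namespace Summit.KontsevichZagierPeriods.Zeta5Search.RVPeriodic

open Finset
open Summit.KontsevichZagierPeriods.Zeta5Search.RayC1
open Summit.KontsevichZagierPeriods.Zeta5Search.ClusterValuation
open Summit.KontsevichZagierPeriods.Zeta5Search.BigPrime (block)

/-! ## §1 Residue counts below `N` -/

section Count

variable (p x : ℕ)

/-- The number of `s < N` with `s ≡ x (mod p)`. -/
def cnt (N : ℕ) : ℕ := ((range N).filter fun s => s % p = x % p).card

/-- Closed form of the residue count: `cnt p x N = N / p + [x % p < N % p]`. -/
theorem cnt_eq (hp : 0 < p) (N : ℕ) : cnt p x N = N / p + if x % p < N % p then 1 else 0 := by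
  rw [← Nat.count_modEq_card N hp x, Nat.count_eq_card_filter_range]
  rfl

/-- Periodicity of the counts: `p` more numbers, one more member. -/
theorem cnt_add_mul (hp : 0 < p) (N k : ℕ) : cnt p x (N + k * p) = cnt p x N + k := by
  rw [cnt_eq p x hp, cnt_eq p x hp, Nat.add_mul_div_right _ _ hp, Nat.add_mul_mod_self_right]
  omega

/-- `cnt p x` is monotone in the length. -/
theorem cnt_mono {M N : ℕ} (h : M ≤ N) : cnt p x M ≤ cnt p x N :=
  card_le_card (filter_subset_filter _ (range_subset_range.2 h))

/-- Splitting the residue count at an intermediate point. -/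
theorem cnt_split {a c : ℕ} (h : a ≤ c) : cnt p x c = cnt p x a + ((Ico a c).filter fun s => s % p = x % p).card := by
  unfold cnt
  rw [range_eq_Ico, range_eq_Ico, ← Ico_union_Ico_eq_Ico (Nat.zero_le a) h, filter_union,
    card_union_of_disjoint (disjoint_filter_filter (Ico_disjoint_Ico_consecutive 0 a c))]

/-- Members of a residue class in `[a, c]` as a difference of counts. -/
theorem card_Icc_filter (a c : ℕ) (h : a ≤ c + 1) :
    ((((Icc a c).filter fun s => s % p = x % p).card : ℕ) : ℤ) = (cnt p x (c + 1) : ℤ) - cnt p x a := by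
  rw [cnt_split p x h, ← Finset.Ico_add_one_right_eq_Icc]
  push_cast
  ring

end Count

/-! ## §2 Class exponents as counts (general `b`) -/

variable {p : ℕ} [hp : Fact p.Prime]

omit hp in
/-- `Σ_{class} blockCount = Σ_j |class ∩ block_j|`. -/
theorem sum_blockCount (b : ℕ → ℤ) (x : ℕ) :
    ∑ s ∈ classSet b p x, (blockCount b s : ℤ) =
      ∑ j ∈ range 7, ((((classSet b p x).filter fun s => s ∈ block (b 0).toNat (b (j + 1)).toNat).card : ℕ) : ℤ) := by
  have h1 : ∀ s, (blockCount b s : ℤ) = ∑ j ∈ range 7, if s ∈ block (b 0).toNat (b (j + 1)).toNat then (1 : ℤ) else 0 := by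
    intro s
    unfold blockCount
    rw [card_filter]
    push_cast
    rfl
  simp_rw [h1]
  rw [sum_comm]
  refine sum_congr rfl fun j _ => ?_
  rw [card_filter]
  push_cast
  rfl

/-- The two centre conventions together contribute `[p ∣ 2x − b₀]` (`p` odd). -/
theorem sum_centre (b : ℕ → ℤ) (h0 : 0 ≤ b 0) (hp2 : p ≠ 2) (x : ℕ) :
    (∑ s ∈ classSet b p x, if 2 * (s : ℤ) = b 0 then (1 : ℤ) else 0) +
      (if ¬ (2 : ℤ) ∣ b 0 ∧ CentreIn b p x then 1 else 0) = if CentreIn b p x then 1 else 0 := by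
  have hpr : Prime (p : ℤ) := Nat.prime_iff_prime_int.1 hp.out
  have hp2' : ¬ (p : ℤ) ∣ 2 := by
    intro h
    have h' : p ∣ 2 := by exact_mod_cast h
    have := Nat.le_of_dvd (by norm_num) h'
    have := hp.out.two_le
    omega
  by_cases h2 : (2 : ℤ) ∣ b 0
  · obtain ⟨c, hc⟩ := h2
    have hc0 : 0 ≤ c := by omega
    have hterm : ∀ s ∈ classSet b p x, (if 2 * (s : ℤ) = b 0 then (1 : ℤ) else 0) = if s = c.toNat then 1 else 0 := by
      intro s _
      have : 2 * (s : ℤ) = b 0 ↔ s = c.toNat := by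
        rw [hc]; constructor
        · intro h; have : (s : ℤ) = c := by omega
          omega
        · intro h; subst h; rw [Int.toNat_of_nonneg hc0]
      simp only [this]
    rw [sum_congr rfl hterm, sum_ite_eq']
    have hnot : ¬ (¬ (2 : ℤ) ∣ b 0 ∧ CentreIn b p x) := fun h => h.1 ⟨c, hc⟩
    rw [if_neg hnot, add_zero]
    have hmem : c.toNat ∈ classSet b p x ↔ CentreIn b p x := by
      simp only [classSet, mem_filter, mem_range, CentreIn]
      constructor
      · rintro ⟨-, hm⟩
        have hd : (p : ℤ) ∣ (x : ℤ) - (c.toNat : ℕ) := (Nat.modEq_iff_dvd.1 hm)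
        rw [Int.toNat_of_nonneg hc0] at hd
        rw [hc, show 2 * (x : ℤ) - 2 * c = 2 * ((x : ℤ) - c) by ring]
        exact hd.mul_left 2
      · intro hd
        rw [hc] at hd
        have hd' : (p : ℤ) ∣ 2 * ((x : ℤ) - c) := by convert hd using 1; ring
        rcases hpr.dvd_or_dvd hd' with h | h
        · exact absurd h hp2'
        · refine ⟨?_, ?_⟩
          · have : c.toNat ≤ (b 0).toNat := Int.toNat_le_toNat (by omega)
            omega
          · have : (p : ℤ) ∣ (x : ℤ) - ((c.toNat : ℕ) : ℤ) := by rwa [Int.toNat_of_nonneg hc0]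
            exact Nat.modEq_iff_dvd.2 this
    by_cases hC : CentreIn b p x
    · rw [if_pos (hmem.2 hC), if_pos hC]
    · rw [if_neg (fun h => hC (hmem.1 h)), if_neg hC]
  · have hzero : ∑ s ∈ classSet b p x, (if 2 * (s : ℤ) = b 0 then (1 : ℤ) else 0) = 0 := by
      refine sum_eq_zero fun s _ => ?_
      rw [if_neg]
      intro h
      exact h2 ⟨s, by omega⟩
    rw [hzero, zero_add]
    by_cases hC : CentreIn b p x
    · rw [if_pos ⟨h2, hC⟩, if_pos hC]
    · rw [if_neg (fun h => hC h.2), if_neg hC]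

/-- **Class exponent as residue counts**: `E_x = |class| − Σ_j |class ∩ block_j| + [p ∣ 2x − b₀]` (`b₀ ≥ 0`, `p` odd). -/
theorem classExp_eq_counts (b : ℕ → ℤ) (h0 : 0 ≤ b 0) (hp2 : p ≠ 2) (x : ℕ) :
    classExp b p x = ((classSet b p x).card : ℤ)
      - (∑ j ∈ range 7, ((((classSet b p x).filter fun s => s ∈ block (b 0).toNat (b (j + 1)).toNat).card : ℕ) : ℤ))
      + (if CentreIn b p x then 1 else 0) := by
  unfold classExp
  have hsplit : ∑ s ∈ classSet b p x, netExp b s =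
      (∑ s ∈ classSet b p x, (1 : ℤ)) - (∑ s ∈ classSet b p x, (blockCount b s : ℤ))
        + ∑ s ∈ classSet b p x, (if 2 * (s : ℤ) = b 0 then (1 : ℤ) else 0) := by
    unfold netExp
    rw [sum_add_distrib, sum_sub_distrib]
  rw [hsplit, sum_blockCount, sum_const, nsmul_eq_mul, mul_one, add_assoc, sum_centre b h0 hp2 x]

/-! ## §3 The ray C1 -/

/-- The slots of `b(n)` as natural numbers. -/
theorem bC1_toNat (n : ℕ) :
    (bC1 n 0).toNat = 85 * n ∧ (bC1 n 1).toNat = 35 * n ∧ (bC1 n 2).toNat = 32 * n ∧ (bC1 n 3).toNat = 30 * n ∧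
      (bC1 n 4).toNat = 27 * n ∧ (bC1 n 5).toNat = 25 * n ∧ (bC1 n 6).toNat = 22 * n ∧ (bC1 n 7).toNat = 20 * n := by
  obtain ⟨h0, h1, h2, h3, h4, h5, h6, h7⟩ := bC1_vals n
  refine ⟨?_, ?_, ?_, ?_, ?_, ?_, ?_, ?_⟩
  · rw [h0]; exact_mod_cast Int.toNat_natCast (85 * n)
  · rw [h1]; exact_mod_cast Int.toNat_natCast (35 * n)
  · rw [h2]; exact_mod_cast Int.toNat_natCast (32 * n)
  · rw [h3]; exact_mod_cast Int.toNat_natCast (30 * n)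
  · rw [h4]; exact_mod_cast Int.toNat_natCast (27 * n)
  · rw [h5]; exact_mod_cast Int.toNat_natCast (25 * n)
  · rw [h6]; exact_mod_cast Int.toNat_natCast (22 * n)
  · rw [h7]; exact_mod_cast Int.toNat_natCast (20 * n)

omit hp in
/-- The C1 ray parameters as naturals: `(bC1 n (j+1)).toNat = βC1 j * n`. -/
theorem bC1_succ_toNat (n : ℕ) {j : ℕ} (hj : j ∈ range 7) : (bC1 n (j + 1)).toNat = βC1 j * n := by
  rw [bC1_succ n hj, Int.toNat_natCast]

omit hp in
/-- The class set of `bC1 n` at residue `x` has `cnt p x (85n+1)` elements. -/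
theorem card_classSet_bC1 (n x : ℕ) : (classSet (bC1 n) p x).card = cnt p x (85 * n + 1) := by
  unfold classSet cnt
  rw [(bC1_toNat n).1]

omit hp in
/-- `|class ∩ block_j| = cnt((85 − β_j)n + 1) − cnt(β_j n)` on the ray. -/
theorem card_block_bC1 (n x : ℕ) {j : ℕ} (hj : j ∈ range 7) :
    ((((classSet (bC1 n) p x).filter fun s => s ∈ block (bC1 n 0).toNat (bC1 n (j + 1)).toNat).card : ℕ) : ℤ)
      = (cnt p x ((85 - βC1 j) * n + 1) : ℤ) - cnt p x (βC1 j * n) := by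
  rw [(bC1_toNat n).1, bC1_succ_toNat n hj]
  have hβ := βC1_le j
  have hset : ((classSet (bC1 n) p x).filter fun s => s ∈ block (85 * n) (βC1 j * n)) =
      (Icc (βC1 j * n) (85 * n - βC1 j * n)).filter fun s => s % p = x % p := by
    ext s
    simp only [classSet, (bC1_toNat n).1, block, mem_filter, mem_range, mem_Icc]
    constructor
    · rintro ⟨⟨_, hm⟩, h1, h2⟩; exact ⟨⟨h1, h2⟩, hm⟩
    · rintro ⟨⟨h1, h2⟩, hm⟩; exact ⟨⟨by omega, hm⟩, h1, h2⟩
  have ht : βC1 j * n ≤ 35 * n := Nat.mul_le_mul_right n hβ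
  have hle : βC1 j * n ≤ 85 * n - βC1 j * n + 1 := by
    generalize βC1 j * n = t at ht ⊢
    omega
  rw [hset, card_Icc_filter p x _ _ hle, show 85 * n - βC1 j * n = (85 - βC1 j) * n from (Nat.sub_mul 85 (βC1 j) n).symm]

/-- **Class exponents of the ray as counts.** -/
theorem classExp_bC1_counts (hp2 : p ≠ 2) (n x : ℕ) : classExp (bC1 n) p x =
    (cnt p x (85 * n + 1) : ℤ) - (∑ j ∈ range 7, ((cnt p x ((85 - βC1 j) * n + 1) : ℤ) - cnt p x (βC1 j * n)))
      + (if CentreIn (bC1 n) p x then 1 else 0) := by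
  rw [classExp_eq_counts (bC1 n) (by rw [(bC1_vals n).1]; positivity) hp2, card_classSet_bC1,
    sum_congr rfl fun j hj => card_block_bC1 n x hj]

omit hp in
/-- The centre class is translation invariant. -/
theorem centreIn_bC1_shift (n x : ℕ) : CentreIn (bC1 (n + p)) p x ↔ CentreIn (bC1 n) p x := by
  unfold CentreIn
  rw [(bC1_vals (n + p)).1, (bC1_vals n).1]
  constructor <;> intro h
  · have := dvd_add h (dvd_mul_left (p : ℤ) 85)
    rwa [show 2 * (x : ℤ) - 85 * ((n + p : ℕ) : ℤ) + 85 * p = 2 * x - 85 * (n : ℕ) by push_cast; ring] at this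
  · have := dvd_sub h (dvd_mul_left (p : ℤ) 85)
    rwa [show 2 * (x : ℤ) - 85 * (n : ℕ) - 85 * p = 2 * x - 85 * ((n + p : ℕ) : ℤ) by push_cast; ring] at this

/-- **SHIFT LAW FOR CLASS EXPONENTS** (`ClassExpShiftLaw` of `RVPeriodicWindows`): `E_x(b(n+p)) = E_x(b(n)) − 128`. -/
theorem classExp_shift (hp2 : p ≠ 2) (n x : ℕ) : classExp (bC1 (n + p)) p x = classExp (bC1 n) p x - 128 := by
  rw [classExp_bC1_counts hp2, classExp_bC1_counts hp2]
  have hc : (if CentreIn (bC1 (n + p)) p x then (1 : ℤ) else 0) = if CentreIn (bC1 n) p x then 1 else 0 := by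
    by_cases h : CentreIn (bC1 n) p x
    · rw [if_pos h, if_pos ((centreIn_bC1_shift n x).2 h)]
    · rw [if_neg h, if_neg (fun h' => h ((centreIn_bC1_shift n x).1 h'))]
  rw [hc]
  have hp0 : 0 < p := hp.out.pos
  have e0 : cnt p x (85 * (n + p) + 1) = cnt p x (85 * n + 1) + 85 := by
    rw [show 85 * (n + p) + 1 = (85 * n + 1) + 85 * p by ring, cnt_add_mul p x hp0]
  have e1 : ∀ j ∈ range 7, ((cnt p x ((85 - βC1 j) * (n + p) + 1) : ℤ) - cnt p x (βC1 j * (n + p)))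
      = ((cnt p x ((85 - βC1 j) * n + 1) : ℤ) - cnt p x (βC1 j * n)) + (85 - 2 * (βC1 j : ℤ)) := by
    intro j _
    have hβ := βC1_le j
    rw [show (85 - βC1 j) * (n + p) + 1 = ((85 - βC1 j) * n + 1) + (85 - βC1 j) * p by ring,
      show βC1 j * (n + p) = βC1 j * n + βC1 j * p by ring, cnt_add_mul p x hp0, cnt_add_mul p x hp0]
    push_cast
    rw [Nat.cast_sub (by omega : βC1 j ≤ 85)]
    push_cast
    ring
  rw [e0, sum_congr rfl e1, sum_add_distrib]
  have hs : ∑ j ∈ range 7, (85 - 2 * (βC1 j : ℤ)) = 213 := by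
    rw [sum_sub_distrib, sum_const, card_range, ← mul_sum]
    have h191 : ∑ j ∈ range 7, (βC1 j : ℤ) = 191 := by exact_mod_cast sum_βC1
    rw [h191]
    norm_num
  rw [hs]
  push_cast
  ring

/-! ## §4 Pole counts -/

omit hp in
/-- The block filter of a position `s` on the ray, membership spelled out. -/
theorem mem_blockFilter_bC1 (n s : ℕ) {j : ℕ} :
    (j ∈ (range 7).filter fun j => s ∈ block (bC1 n 0).toNat (bC1 n (j + 1)).toNat) ↔
      j < 7 ∧ βC1 j * n ≤ s ∧ s ≤ 85 * n - βC1 j * n := by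
  constructor
  · intro h
    rw [mem_filter, mem_range] at h
    have hj : j ∈ range 7 := mem_range.2 h.1
    have h2 := h.2
    rw [(bC1_toNat n).1, bC1_succ_toNat n hj, block, mem_Icc] at h2
    exact ⟨h.1, h2.1, h2.2⟩
  · rintro ⟨hj, h1, h2⟩
    have hj' : j ∈ range 7 := mem_range.2 hj
    rw [mem_filter, (bC1_toNat n).1, bC1_succ_toNat n hj', block, mem_Icc]
    exact ⟨hj', h1, h2⟩

omit hp in
/-- On the ray the poles are exactly the positions of depth `≥ 2`: `22n ≤ s ≤ 63n` (the blocks are nested, `β₅ = 22`). -/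
theorem netExp_bC1_neg_iff (n s : ℕ) : netExp (bC1 n) s < 0 ↔ 22 * n ≤ s ∧ s ≤ 63 * n := by
  have hβ22 : ∀ j ∈ range 7, j ≠ 6 → 22 ≤ βC1 j := by decide
  have hβ5 : βC1 5 = 22 := by decide
  have hβ6 : βC1 6 = 20 := by decide
  set F := (range 7).filter fun j => s ∈ block (bC1 n 0).toNat (bC1 n (j + 1)).toNat with hF
  have hbc : blockCount (bC1 n) s = F.card := rfl
  -- inside `[22n, 63n]`: blocks 5 and 6 both contain `s`
  have hge : 22 * n ≤ s ∧ s ≤ 63 * n → 2 ≤ F.card := by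
    rintro ⟨h1, h2⟩
    have hsub : ({5, 6} : Finset ℕ) ⊆ F := by
      intro j hj
      simp only [mem_insert, mem_singleton] at hj
      rcases hj with rfl | rfl
      · exact (mem_blockFilter_bC1 n s).2 ⟨by norm_num, by rw [hβ5]; omega, by rw [hβ5]; omega⟩
      · exact (mem_blockFilter_bC1 n s).2 ⟨by norm_num, by rw [hβ6]; omega, by rw [hβ6]; omega⟩
    simpa using card_le_card hsub
  -- outside: only block 6 can contain `s`
  have hle : ¬ (22 * n ≤ s ∧ s ≤ 63 * n) → F.card ≤ 1 := by
    intro hA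
    have hsub : F ⊆ {6} := by
      intro j hj
      rw [mem_singleton]
      by_contra hj6
      obtain ⟨hj7, h1, h2⟩ := (mem_blockFilter_bC1 n s).1 hj
      have h22 := hβ22 j (mem_range.2 hj7) hj6
      have ht : 22 * n ≤ βC1 j * n := Nat.mul_le_mul_right n h22
      apply hA
      generalize βC1 j * n = t at ht h1 h2
      omega
    simpa using card_le_card hsub
  -- the centre lies in every block
  have hcentre : 2 * (s : ℤ) = bC1 n 0 → F.card = 7 := by
    intro hc
    rw [(bC1_vals n).1] at hc
    have hc' : 2 * s = 85 * n := by exact_mod_cast hc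
    have hall : F = range 7 := by
      rw [hF]
      refine filter_true_of_mem fun j hj => ?_
      rw [(bC1_toNat n).1, bC1_succ_toNat n hj, block, mem_Icc]
      have ht : βC1 j * n ≤ 35 * n := Nat.mul_le_mul_right n (βC1_le j)
      generalize βC1 j * n = t at ht
      omega
    rw [hall, card_range]
  unfold netExp
  rw [hbc]
  constructor
  · intro hneg
    by_contra hA
    have h1 := hle hA
    have hc : ¬ (2 * (s : ℤ) = bC1 n 0) := fun h => by have := hcentre h; omega
    rw [if_neg hc] at hneg
    omega
  · intro hA
    have h2 := hge hA
    by_cases hc : 2 * (s : ℤ) = bC1 n 0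
    · rw [if_pos hc, hcentre hc]
      norm_num
    · rw [if_neg hc]
      omega

omit hp in
/-- **Pole counts of the ray as counts.** -/
theorem classPoleCount_bC1 (n x : ℕ) : classPoleCount (bC1 n) p x = cnt p x (63 * n + 1) - cnt p x (22 * n) := by
  unfold classPoleCount
  have hset : ((classSet (bC1 n) p x).filter fun s => netExp (bC1 n) s < 0) =
      (Icc (22 * n) (63 * n)).filter fun s => s % p = x % p := by
    ext s
    simp only [classSet, mem_filter, mem_range, mem_Icc, (bC1_toNat n).1]
    constructor
    · rintro ⟨⟨hs, hm⟩, hneg⟩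
      have := (netExp_bC1_neg_iff n s).1 hneg
      exact ⟨⟨this.1, this.2⟩, hm⟩
    · rintro ⟨⟨h1, h2⟩, hm⟩
      exact ⟨⟨by omega, hm⟩, (netExp_bC1_neg_iff n s).2 ⟨h1, h2⟩⟩
  rw [hset]
  have h := card_Icc_filter p x (22 * n) (63 * n) (by omega)
  have hle := cnt_mono p x (show 22 * n ≤ 63 * n + 1 by omega)
  omega

/-- **SHIFT LAW FOR POLE COUNTS** (`PoleCountShiftLaw` of `RVPeriodicWindows`): every class gains exactly `41` poles. -/
theorem classPoleCount_shift (n x : ℕ) : classPoleCount (bC1 (n + p)) p x = classPoleCount (bC1 n) p x + 41 := by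
  rw [classPoleCount_bC1, classPoleCount_bC1, show 63 * (n + p) + 1 = (63 * n + 1) + 63 * p by ring,
    show 22 * (n + p) = 22 * n + 22 * p by ring, cnt_add_mul p x hp.out.pos, cnt_add_mul p x hp.out.pos]
  have := cnt_mono p x (show 22 * n ≤ 63 * n + 1 by omega)
  omega

/-- Below `θ = 1` (`p ≤ n`) every class has at least `40` poles — in particular no single-pole classes. -/
theorem classPoleCount_ge (n x : ℕ) (hpn : p ≤ n) : 40 ≤ classPoleCount (bC1 n) p x := by
  have hp0 : 0 < p := hp.out.pos
  rw [classPoleCount_bC1, cnt_eq p x hp0, cnt_eq p x hp0]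
  -- `(63n+1)/p − 22n/p ≥ 41`: `22n = q·p + r`, `63n + 1 ≥ 22n + 41p`
  have h1 : 22 * n / p + 41 ≤ (63 * n + 1) / p := by
    apply (Nat.le_div_iff_mul_le hp0).2
    have := Nat.div_mul_le_self (22 * n) p
    nlinarith
  split_ifs <;> omega

end Summit.KontsevichZagierPeriods.Zeta5Search.RVPeriodic
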